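import Literature.NumberTheory.EllipticCurves.Kriz2020.RankOnePConverse
import Literature.NumberTheory.EllipticCurves.BSDSelmerCMPConverseGoldfeldProofs
import Literature.NumberTheory.EllipticCurves.BSDSelmerSmithRootNumberDensityProofs
import Literature.NumberTheory.EllipticCurves.BSDRootNumberModularityOnlyProofs
import Literature.NumberTheory.EllipticCurves.LeadingTerm
import Literature.NumberTheory.EllipticCurves.CongruentNumberCurveConductorSign
import Literature.NumberTheory.EllipticCurves.BSDSelmerSmithDecomposition
import HarnessLib

/-!
# Kříž 2020, Theorem 10.17 (2)–(3) as CONDITIONAL theorems: the BSD rank formula for `100 %` of the quadratic twists of `y² = x³ − x`, and `100 %` of the squarefree `n ≡ 5, 6, 7 (mod 8)` are congruent numbers — modulo ONE named hypothesis, Kříž's rank-one `2`-converse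

HONEST FRAMING (cell `bsd-cn100`, `run/shared/lean/pub/bsd-cn100/`). Proof companion of
`Kriz2020/RankOnePConverse.lean` (theorems only: no definition, no named fact, no instance;
D-0026). Everything here is PROVED from named facts of the tree carried as explicit hypotheses;
the only input taken from the unrefereed preprint arXiv:2002.04767 is the binder
`(hK : rankOne_twoConverse_congruentNumber)` — "`corank_{ℤ_2} Sel_{2^∞}(E_n/ℚ) = 1 ⟹
ord_{s=1} L(E_n, s) = 1` for `E_n : y² = x³ − n²x`" (v5 Thm. 10.17 (2), an instance of v5
Thm. 10.13; status and the cell's gap ledgers in the sibling file). The other hypotheses are named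
facts of the tree, with the following STATUS IN PRINT (precised 2026-08-25 on the cell referee's
scoring, `STATEMENT-SCORES.md` File 3 §S3: the Smith input has an unrefereed and a refereed form,
and this file now carries both):

* `hS : smith_selmerCorank_density (congruentNumberCurve 1)` — A. Smith, arXiv:2503.17619 (2025),
  Thm. 1.1, instance `E : y² = x³ − x`: among the squarefree `d` (both signs, by `|d|`),
  `corank Sel_{2^∞}(E^d) = 0`, resp. `= 1`, for density `1/2` each. As a statement for EVERY `E/ℚ`,
  arXiv:2503.17619 is an UNREFEREED preprint (v1, March 2025). For THIS curve — full rational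
  `2`-torsion, no rational cyclic `4`-isogeny — the distribution is REFEREED print: A. Smith,
  *The distribution of `ℓ^∞`-Selmer groups in degree `ℓ` twist families I*, J. Amer. Math. Soc. 39
  (2026), doi:10.1090/jams/1062 (= arXiv:2207.05674), Thm. 1.2 under its Assumption 1.1 (3) (tree:
  the named fact `smith2022_selmerCorank_distribution` over `smi22aAssumption`), the assumption
  being PROVED for `y² = x³ − x` in the tree (`smithCaseI_example`: `E(ℚ)[2] ≅ (ℤ/2)²` and no
  balanced isogeny, `⟺` no cyclic `4`-isogeny by `smi22aAssumption_iff_smithCaseI_or_smithCaseII`;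
  in print: Smith, arXiv:1702.02325, p. 2 — the reference `[Smith, Thm. 1.2]` of Kříž's proof —,
  Burungale–Tian, Ann. of Math. 203 (2026), Thm. 3.3, and Heath-Brown, Invent. Math. 118 (1994),
  Thm. 1–2, for the `2`-Selmer distribution). Every theorem below that takes `hS` has a twin
  `…_of_smith2022` taking instead `h22 : smith2022_selmerCorank_distribution` (last section), on
  which route `hK` is LITERALLY the only unrefereed binder;
* `hBT : burungaleTian_analyticRank_eq_zero_of_selmerCorank_eq_zero_of_hasCM` — the rank-ZERO
  `p`-converse for CM curves, Burungale–Tian, Ann. of Math. 203 (2026), Thm. 1.1 (refereed), used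
  at `p = 2`: the case `r_2 = 0` of Kříž's Thm. 10.17 (2) is therefore NOT charged to the preprint;
* `hGZK : rank_eq_analyticRank_of_analyticRank_le_one` — Gross–Zagier–Kolyvagin (bsd.S17; refereed);
* `hmod : ModularForms.exists_isNewformOf` — Modularity (Wiles, Taylor–Wiles, BCDT; refereed), only
  where the density of a root-number class (`twistDensity_rootNumber_quadraticTwist_eq_neg_one`) or
  the parity `(−1)^{r_an} = w` is needed.

## What is proved (tree vocabulary: `twistDensity P δ` = "`#{d sqfree, |d| ≤ X, P d} / #{d sqfree, |d| ≤ X} → δ`"; `E^d := (congruentNumberCurve 1).quadraticTwist d = congruentNumberCurve |d|`, `quadraticTwist_congruentNumberCurve_one`)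

1. `rankOne_twoConverse_congruentNumber_of_cmRamified`,
   `rankOne_threeConverse_mordellCurve_of_cmRamified`: the two special cases ARE instances of the
   general claim v5 Thm. 10.13 (`j = 1728`, `2 ∣ d_K = −4`; `j = 0`, `3 ∣ d_K = −3`).
2. `analyticRank_eq_mordellWeilRank_congruentNumberCurve_of_selmerCorank_le_one`: for ONE `n ≠ 0`
   with `r_2(E_n) ≤ 1`, `hBT`, `hK`, `hGZK` give `r_an(E_n) = r_MW(E_n)` (display
   (congruentconclusion) of v5 Thm. 10.17 (2), rank part).
3. `twistDensity_analyticRank_eq_one_congruentNumberCurve_of_converse`: `r_an(E^d) = 1` for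
   density `1/2` of the squarefree `d` — the ODD half of Goldfeld's conjecture for the congruent
   number family, complementing the tree's even half
   `twistDensity_analyticRank_eq_zero_congruentNumberCurve_of_burungaleTian`; the Monsky-free even
   half `twistDensity_analyticRank_eq_zero_congruentNumberCurve_of_converse` (given `hK`, `r_2 = 0 ↔
   r_an = 0` on `{r_2 ≤ 1}`) and their conjunction `goldfeld_congruentNumberCurve_of_converse` —
   v5 Thm. 10.17 (3): "Goldfeld's conjecture is true for the congruent number family".
4. `bsdRank_densityOne_congruentNumber_of_converse` (the cell's named consumer):
   `r_an(E^d) = r_MW(E^d)` — the rank part of the Birch–Swinnerton-Dyer conjecture,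
   `Literature.BSDRankConjecture` restricted to this family — for a density-ONE set of squarefree `d`;
   `bsdRank_densityOne_congruentNumber_of_converse'` the same read on `E_{|d|}`.
5. `twistDensity_isCongruentNumber_of_mod_eight_of_converse`: density one of
   "`|d| ≡ 5, 6, 7 (mod 8) ⟹ |d|` is a congruent number"; with Modularity,
   `twistDensity_mod_eight_congruentNumber` (the class has density `1/2`),
   `twistDensity_mod_eight_and_isCongruentNumber_of_converse` (so does its congruent part) and the
   printed conditional form `tendsto_card_isCongruentNumber_div_card_mod_eight_of_converse`:
   `#{d sqfree, |d| ≤ X, |d| ≡ 5,6,7 (8), |d| congruent} / #{d sqfree, |d| ≤ X, |d| ≡ 5,6,7 (8)} → 1`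
   — v5 Thm. 10.17 (3), second clause ("100% of squarefree positive integers `d ≡ 5, 6, 7 (mod 8)`
   are congruent numbers"; both signs of `d` name the same `|d|`, so the ratio is the printed one),
   and the same ratio over the positive integers `n ≤ X`,
   `tendsto_card_isCongruentNumber_div_card_mod_eight_nat_of_converse` (two-to-one symmetry
   `d = ±n`).
6. `twistDensity_not_isCongruentNumber_of_mod_eight_of_converse`: density one of
   "`|d| ≡ 1, 2, 3 (mod 8) ⟹ |d|` is not a congruent number" (v5 Thm. 10.17 (3), first clause;
   here `hK` only excludes `r_2 = 1` on the root-number-`+1` classes via parity, `hmod`).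
7. (Refereed route for the Smith input.) `smi22aAssumption_congruentNumberCurve` (every
   `E_n`, `n ≠ 0`, satisfies JAMS Assumption 1.1 (3): `x(x − n)(x + n)` with `−n²`, `2n²` not
   squares — `smithCaseI_iff_of_roots`), `smith_selmerCorank_density_congruentNumberCurve_one_of_smith2022`
   (`h22 ⟹ hS` for `y² = x³ − x`, by `smith_selmerCorank_density_of_smi22a_printed`), and the twins
   `goldfeld_congruentNumberCurve_of_converse_of_smith2022`,
   `bsdRank_densityOne_congruentNumber_of_converse_of_smith2022`,
   `twistDensity_isCongruentNumber_of_mod_eight_of_converse_of_smith2022`,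
   `tendsto_card_isCongruentNumber_div_card_mod_eight_nat_of_converse_of_smith2022`,
   `twistDensity_not_isCongruentNumber_of_mod_eight_of_converse_of_smith2022`: the same conclusions
   with `h22 : smith2022_selmerCorank_distribution` (J. Amer. Math. Soc. 2026, Thm. 1.2) in place of
   `hS` — trust base: ONE unrefereed binder (`hK`) + refereed print (Smith JAMS 2026, Burungale–Tian
   Annals 2026, Gross–Zagier 1986 / Kolyvagin 1990, Modularity).

The squarefree-`d ∈ ℤ` normalisation is the tree's (`BSDSelmer.twistDensity`, Smith §1); for this
family `E^{d} = E^{−d} = E_{|d|}` literally, so densities over squarefree `d ∈ ℤ` and over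
squarefree `n ∈ ℕ` coincide.
-/

noncomputable section

open scoped Classical

open Filter Topology WeierstrassCurve
open Literature.NumberTheory.EllipticCurves.ModularForms

namespace Literature.NumberTheory.EllipticCurves

/-! ### The special cases are instances of the general claim -/

/-- **v5 Thm. 10.17 (2) ⊂ v5 Thm. 10.13**: the congruent number curve `E_n` (`n ≠ 0`) has
`j = 1728 ∈ maximalCMJInvariants` (`congruentNumberCurve_j`, CM by `ℤ[i]`) and `2 ∣ d_K = −4`
(`Rank1Residual.cmFieldDiscrOfJ 1728 = −4`), so Kříž's general rank-one `p`-converse at ramified `p`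
specialises to `rankOne_twoConverse_congruentNumber`. [cite: Kriz2020, proof of Thm. 10.17 (v5, SP_v5.tex l. 11025)] -/
theorem rankOne_twoConverse_congruentNumber_of_cmRamified
    (h : kriz_analyticRank_eq_one_of_selmerCorank_eq_one_of_cmRamified) :
    rankOne_twoConverse_congruentNumber := by
  intro n hn h1
  haveI := isElliptic_congruentNumberCurve hn
  haveI : Fact (Nat.Prime 2) := ⟨Nat.prime_two⟩
  have hram : Rank1Residual.CMRamified (congruentNumberCurve n) 2 := by
    show ((2 : ℕ) : ℤ) ∣ Rank1Residual.cmFieldDiscrOfJ (congruentNumberCurve n).j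
    rw [congruentNumberCurve_j]
    norm_num [Rank1Residual.cmFieldDiscrOfJ]
  exact h (congruentNumberCurve n) (congruentNumberCurve_j_mem_maximalCMJInvariants n) 2 hram h1

/-- **v5 Thm. 10.14 ⊂ v5 Thm. 10.13**: `mordellCurve D : y² = x³ + D` (`D ≠ 0`) has `c₄ = 0`, so
`j = 0 ∈ maximalCMJInvariants` (CM by `ℤ[(1+√−3)/2]`) and `3 ∣ d_K = −3`, so the general claim at
`p = 3` specialises to `rankOne_threeConverse_mordellCurve`. [cite: Kriz2020, proof of Thm. 10.14 (v5, SP_v5.tex l. 10971)] -/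
theorem rankOne_threeConverse_mordellCurve_of_cmRamified
    (h : kriz_analyticRank_eq_one_of_selmerCorank_eq_one_of_cmRamified) :
    rankOne_threeConverse_mordellCurve := by
  intro D hD h1
  haveI := isElliptic_mordellCurve hD
  haveI : Fact (Nat.Prime 3) := ⟨Nat.prime_three⟩
  have hj : (mordellCurve D).j = 0 := (mordellCurve D).j_eq_zero (mordellCurve_c₄ D)
  have hmem : (mordellCurve D).j ∈ maximalCMJInvariants := by
    rw [hj]; simp [maximalCMJInvariants]
  have hram : Rank1Residual.CMRamified (mordellCurve D) 3 := by
    show ((3 : ℕ) : ℤ) ∣ Rank1Residual.cmFieldDiscrOfJ (mordellCurve D).j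
    rw [hj]
    norm_num [Rank1Residual.cmFieldDiscrOfJ]
  exact h (mordellCurve D) hmem 3 hram h1

/-! ### One twist: `r_2(E_n) ≤ 1 ⟹ r_an(E_n) = r_MW(E_n)` -/

/-- **`E₁^{(d)} = E_{|d|}`**: the quadratic twist of `y² = x³ − x` by an integer `d` is the
congruent number curve `y² = x³ − d²x`, as Weierstrass models (`a₄ ↦ d² a₄`, `a₆ = 0`). [folklore] -/
private theorem quadraticTwist_congruentNumberCurve_one (d : ℤ) :
    (congruentNumberCurve 1).quadraticTwist (d : ℚ) = congruentNumberCurve d.natAbs := by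
  have hd : ((d.natAbs : ℕ) : ℚ) ^ 2 = (d : ℚ) ^ 2 := by
    rw [Nat.cast_natAbs, Int.cast_abs, sq_abs]
  ext
  · rfl
  · simp [quadraticTwist, congruentNumberCurve, WeierstrassCurve.b₂]
  · rfl
  · simp only [quadraticTwist, congruentNumberCurve, WeierstrassCurve.b₄]
    rw [hd]; ring
  · simp [quadraticTwist, congruentNumberCurve, WeierstrassCurve.b₆]

/-- **Display (congruentconclusion) of Kříž, v5 Thm. 10.17 (2), rank part, for ONE curve, as a
conditional theorem.** For `n ≠ 0` with `corank_{ℤ_2} Sel_{2^∞}(E_n/ℚ) ≤ 1`: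
`ord_{s=1} L(E_n, s) = rank_ℤ E_n(ℚ)`. Corank `0`: Burungale–Tian's rank-zero `2`-converse for the
CM curve `E_n` (`j = 1728`, `hasCM_of_j_mem_maximalCMJInvariants_holds`) gives `r_an = 0`, and
`rank ≤ corank = 0` (`selmerCorank_eq_mordellWeilRank_add_holds`, Greenberg 1999 §1). Corank `1`:
the HYPOTHESIS `hK` gives `r_an = 1`, and Gross–Zagier–Kolyvagin (`hGZK`, bsd.S17) gives `rank = 1`.
[cite: Kriz2020, Thm. 10.17 (2) (v5)] [cite: Darmon2004, Thm. 3.22] -/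
theorem analyticRank_eq_mordellWeilRank_congruentNumberCurve_of_selmerCorank_le_one
    (hBT : burungaleTian_analyticRank_eq_zero_of_selmerCorank_eq_zero_of_hasCM)
    (hK : rankOne_twoConverse_congruentNumber)
    (hGZK : rank_eq_analyticRank_of_analyticRank_le_one)
    {n : ℕ} (hn : n ≠ 0) (hle : (congruentNumberCurve n).selmerCorank 2 ≤ 1) :
    (congruentNumberCurve n).analyticRank = (congruentNumberCurve n).mordellWeilRank := by
  haveI := isElliptic_congruentNumberCurve hn
  haveI : Fact (Nat.Prime 2) := ⟨Nat.prime_two⟩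
  have hCM : (congruentNumberCurve n).HasCM :=
    hasCM_of_j_mem_maximalCMJInvariants_holds _ (congruentNumberCurve_j_mem_maximalCMJInvariants n)
  rcases Nat.le_one_iff_eq_zero_or_eq_one.mp hle with h0 | h1
  · have han : (congruentNumberCurve n).analyticRank = 0 := hBT _ hCM 2 h0
    have hrk : (congruentNumberCurve n).mordellWeilRank ≤ (congruentNumberCurve n).selmerCorank 2 := by
      rw [(congruentNumberCurve n).selmerCorank_eq_mordellWeilRank_add_holds 2]
      exact Nat.le_add_right _ _
    omega
  · have han : (congruentNumberCurve n).analyticRank = 1 := hK hn h1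
    exact ((hGZK (congruentNumberCurve n) (by rw [han])).1).symm

/-- The same conclusion read as `IsCongruentNumber`: for squarefree `n ≡ 5, 6, 7 (mod 8)` with
`r_2(E_n) ≤ 1`, `n` is a congruent number — `L(E_n, 1) = 0` on these classes
(`entireLFunction_congruentNumberCurve_one_eq_zero_of_mod_eight`, the sign of the functional
equation, unconditional in the tree) and the BSD rank formula just proved
(`isCongruentNumber_of_mod_eight_of_BSD'`). [cite: Kriz2020, Thm. 10.17 (2) (v5), "if r_2(E^d/ℚ) = 1 then |d| is a congruent number"] -/
theorem isCongruentNumber_of_mod_eight_of_selmerCorank_le_one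
    (hBT : burungaleTian_analyticRank_eq_zero_of_selmerCorank_eq_zero_of_hasCM)
    (hK : rankOne_twoConverse_congruentNumber)
    (hGZK : rank_eq_analyticRank_of_analyticRank_le_one)
    {n : ℕ} (hsq : Squarefree n) (h8 : n % 8 = 5 ∨ n % 8 = 6 ∨ n % 8 = 7)
    (hle : (congruentNumberCurve n).selmerCorank 2 ≤ 1) : IsCongruentNumber n :=
  isCongruentNumber_of_mod_eight_of_BSD' hsq h8
    (analyticRank_eq_mordellWeilRank_congruentNumberCurve_of_selmerCorank_le_one hBT hK hGZK
      hsq.ne_zero hle)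

/-! ### Densities in the twist family of `E : y² = x³ − x` -/

/-- **The odd half of Goldfeld's conjecture for the congruent number family, conditionally**
(Kříž, v5 Thm. 10.17 (3) "Goldfeld's conjecture is true for the congruent number family", odd
part): `ord_{s=1} L(E^d, s) = 1` for a set of squarefree `d` of density `1/2`. On the density-one
set `{r_2(E^d) ≤ 1}` (`twistDensity_selmerCorankTwoInfty_le_one_of`, Smith Thm. 1.1) the conditions
"`r_2(E^d) = 1`" and "`r_an(E^d) = 1`" agree: `⟹` is the hypothesis `hK`; `⟸` because `r_2 = 0`
would force `r_an = 0` (Burungale–Tian). Hence both have the density of `{r_2 = 1}`, namely `1/2`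
(`twistDensity_congr_of_one`). [cite: Kriz2020, Thm. 10.17 (3) (v5)] [cite: SmithGoldfeld2025, Thm. 1.1] -/
theorem twistDensity_analyticRank_eq_one_congruentNumberCurve_of_converse
    (hBT : burungaleTian_analyticRank_eq_zero_of_selmerCorank_eq_zero_of_hasCM)
    (hK : rankOne_twoConverse_congruentNumber)
    (hS : smith_selmerCorank_density (congruentNumberCurve 1)) :
    twistDensity
      (fun d ↦ d ≠ 0 ∧ ((congruentNumberCurve 1).quadraticTwist d).analyticRank = 1) (1 / 2) := by
  have hR := twistDensity_selmerCorankTwoInfty_le_one_of (congruentNumberCurve 1) hS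
  have key : ∀ d : ℤ, Squarefree d →
      (d ≠ 0 ∧ selmerCorankTwoInfty ((congruentNumberCurve 1).quadraticTwist d) ≤ 1) →
        ((d ≠ 0 ∧ selmerCorankTwoInfty ((congruentNumberCurve 1).quadraticTwist d) = 1) ↔
          (d ≠ 0 ∧ ((congruentNumberCurve 1).quadraticTwist d).analyticRank = 1)) := by
    rintro d - ⟨hd, hle⟩
    rw [selmerCorankTwoInfty_eq, quadraticTwist_congruentNumberCurve_one] at hle ⊢
    have hn : d.natAbs ≠ 0 := Int.natAbs_ne_zero.mpr hd
    haveI := isElliptic_congruentNumberCurve hn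
    haveI : Fact (Nat.Prime 2) := ⟨Nat.prime_two⟩
    have hCM : (congruentNumberCurve d.natAbs).HasCM :=
      hasCM_of_j_mem_maximalCMJInvariants_holds _
        (congruentNumberCurve_j_mem_maximalCMJInvariants d.natAbs)
    refine ⟨fun h ↦ ⟨hd, hK hn h.2⟩, fun h ↦ ⟨hd, ?_⟩⟩
    rcases Nat.le_one_iff_eq_zero_or_eq_one.mp hle with h0 | h1
    · have := hBT _ hCM 2 h0
      rw [h.2] at this
      exact absurd this one_ne_zero
    · exact h1
  exact (twistDensity_congr_of_one hR key).1 hS.2.1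

/-- **The even half without Monsky's parity input, conditionally**: `ord_{s=1} L(E^d, s) = 0` for a
set of squarefree `d` of density `1/2`. (The tree's unconditional-in-`hK` version
`twistDensity_analyticRank_eq_zero_of_hasCM_of_burungaleTian` uses Monsky's `r_2 ≡ r_an (mod 2)`
instead; here, on `{r_2(E^d) ≤ 1}`, "`r_2 = 0`" and "`r_an = 0`" agree because `r_2 = 1` would give
`r_an = 1` by `hK`, and `r_2 = 0` gives `r_an = 0` by Burungale–Tian.)
[cite: Kriz2020, Thm. 10.17 (3) (v5)] [cite: SmithGoldfeld2025, Thm. 1.1] -/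
theorem twistDensity_analyticRank_eq_zero_congruentNumberCurve_of_converse
    (hBT : burungaleTian_analyticRank_eq_zero_of_selmerCorank_eq_zero_of_hasCM)
    (hK : rankOne_twoConverse_congruentNumber)
    (hS : smith_selmerCorank_density (congruentNumberCurve 1)) :
    twistDensity
      (fun d ↦ d ≠ 0 ∧ ((congruentNumberCurve 1).quadraticTwist d).analyticRank = 0) (1 / 2) := by
  have hR := twistDensity_selmerCorankTwoInfty_le_one_of (congruentNumberCurve 1) hS
  have key : ∀ d : ℤ, Squarefree d →
      (d ≠ 0 ∧ selmerCorankTwoInfty ((congruentNumberCurve 1).quadraticTwist d) ≤ 1) →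
        ((d ≠ 0 ∧ selmerCorankTwoInfty ((congruentNumberCurve 1).quadraticTwist d) = 0) ↔
          (d ≠ 0 ∧ ((congruentNumberCurve 1).quadraticTwist d).analyticRank = 0)) := by
    rintro d - ⟨hd, hle⟩
    rw [selmerCorankTwoInfty_eq, quadraticTwist_congruentNumberCurve_one] at hle ⊢
    have hn : d.natAbs ≠ 0 := Int.natAbs_ne_zero.mpr hd
    haveI := isElliptic_congruentNumberCurve hn
    haveI : Fact (Nat.Prime 2) := ⟨Nat.prime_two⟩
    have hCM : (congruentNumberCurve d.natAbs).HasCM :=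
      hasCM_of_j_mem_maximalCMJInvariants_holds _
        (congruentNumberCurve_j_mem_maximalCMJInvariants d.natAbs)
    refine ⟨fun h ↦ ⟨hd, hBT _ hCM 2 h.2⟩, fun h ↦ ⟨hd, ?_⟩⟩
    rcases Nat.le_one_iff_eq_zero_or_eq_one.mp hle with h0 | h1
    · exact h0
    · have := hK hn h1
      rw [h.2] at this
      exact absurd this.symm one_ne_zero
  exact (twistDensity_congr_of_one hR key).1 hS.1

/-- **Goldfeld's conjecture for the congruent number family `E^d : y² = x³ − d²x`, conditionally**
(Kříž, v5 Thm. 10.17 (3): "Goldfeld's conjecture [Goldfeld] is true for the congruent number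
family"; Thm. 10.17 (1) for `E = y² = x³ − x`): `50 %` of the quadratic twists have analytic rank
`0` and `50 %` have analytic rank `1` (so `100 %` have analytic rank `≤ 1` and the average analytic
rank is `1/2`). Hypotheses: Burungale–Tian (rank-`0` `2`-converse, Ann. of Math. 2026, refereed),
KŘÍŽ (`hK`, the input from the unrefereed preprint under review), Smith's Thm. 1.1 for `y² = x³ − x`
(`hS`; arXiv:2503.17619 is unrefereed — the twin `goldfeld_congruentNumberCurve_of_converse_of_smith2022`
takes the refereed J. Amer. Math. Soc. 2026 form instead).
[cite: Kriz2020, Thm. 10.17 (1), (3) (v5; = Cor. 8.9 of v1)] [cite: SmithGoldfeld2025, Thm. 1.1 and Cor. 1.2] -/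
theorem goldfeld_congruentNumberCurve_of_converse
    (hBT : burungaleTian_analyticRank_eq_zero_of_selmerCorank_eq_zero_of_hasCM)
    (hK : rankOne_twoConverse_congruentNumber)
    (hS : smith_selmerCorank_density (congruentNumberCurve 1)) :
    twistDensity
        (fun d ↦ d ≠ 0 ∧ ((congruentNumberCurve 1).quadraticTwist d).analyticRank = 0) (1 / 2) ∧
      twistDensity
        (fun d ↦ d ≠ 0 ∧ ((congruentNumberCurve 1).quadraticTwist d).analyticRank = 1) (1 / 2) :=
  ⟨twistDensity_analyticRank_eq_zero_congruentNumberCurve_of_converse hBT hK hS,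
    twistDensity_analyticRank_eq_one_congruentNumberCurve_of_converse hBT hK hS⟩

/-- **The cell's consumer — Kříž, v5 Thm. 10.17 (2)–(3), rank part, as a conditional density-one
theorem: the Birch–Swinnerton-Dyer RANK formula holds for `100 %` of the quadratic twists of
`y² = x³ − x`.** Among the squarefree `d` (both signs, ordered by `|d|`), the set of `d` with
`ord_{s=1} L(E^d, s) = rank_ℤ E^d(ℚ)` has density `1`: it contains `{r_2(E^d) ≤ 1}`, of density one
by Smith's Thm. 1.1 (`twistDensity_selmerCorankTwoInfty_le_one_of`), on which
`analyticRank_eq_mordellWeilRank_congruentNumberCurve_of_selmerCorank_le_one` applies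
(`E^d = E_{|d|}`). Hypotheses: Burungale–Tian (rank-`0` converse, Ann. of Math. 2026, refereed),
KŘÍŽ (rank-`1` converse, the input from the unrefereed preprint under review),
Gross–Zagier–Kolyvagin (refereed), Smith's Thm. 1.1 for `y² = x³ − x` (`hS`; arXiv:2503.17619 is
unrefereed — the twin `bsdRank_densityOne_congruentNumber_of_converse_of_smith2022` takes the
refereed J. Amer. Math. Soc. 2026 form, on which route `hK` is the only unrefereed binder).
[cite: Kriz2020, Thm. 10.17 (2)-(3) (v5)] [cite: SmithGoldfeld2025, Thm. 1.1] -/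
theorem bsdRank_densityOne_congruentNumber_of_converse
    (hBT : burungaleTian_analyticRank_eq_zero_of_selmerCorank_eq_zero_of_hasCM)
    (hK : rankOne_twoConverse_congruentNumber)
    (hGZK : rank_eq_analyticRank_of_analyticRank_le_one)
    (hS : smith_selmerCorank_density (congruentNumberCurve 1)) :
    twistDensity (fun d ↦ d ≠ 0 →
      ((congruentNumberCurve 1).quadraticTwist d).analyticRank =
        ((congruentNumberCurve 1).quadraticTwist d).mordellWeilRank) 1 := by
  refine twistDensity_one_mono (fun d _ hRd hd ↦ ?_)
    (twistDensity_selmerCorankTwoInfty_le_one_of (congruentNumberCurve 1) hS)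
  obtain ⟨-, hle⟩ := hRd
  rw [selmerCorankTwoInfty_eq, quadraticTwist_congruentNumberCurve_one] at hle
  rw [quadraticTwist_congruentNumberCurve_one]
  exact analyticRank_eq_mordellWeilRank_congruentNumberCurve_of_selmerCorank_le_one hBT hK hGZK
    (Int.natAbs_ne_zero.mpr hd) hle

/-- The consumer read on the congruent number curves themselves: `ord_{s=1} L(E_{|d|}, s) =
rank_ℤ E_{|d|}(ℚ)` for a density-one set of squarefree `d` (`E^d = E_{|d|}`,
`quadraticTwist_congruentNumberCurve_one`). [cite: Kriz2020, Thm. 10.17 (2)-(3) (v5)] -/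
theorem bsdRank_densityOne_congruentNumber_of_converse'
    (hBT : burungaleTian_analyticRank_eq_zero_of_selmerCorank_eq_zero_of_hasCM)
    (hK : rankOne_twoConverse_congruentNumber)
    (hGZK : rank_eq_analyticRank_of_analyticRank_le_one)
    (hS : smith_selmerCorank_density (congruentNumberCurve 1)) :
    twistDensity (fun d ↦ (congruentNumberCurve d.natAbs).analyticRank =
      (congruentNumberCurve d.natAbs).mordellWeilRank) 1 := by
  refine twistDensity_one_mono (fun d hsq h ↦ ?_)
    (bsdRank_densityOne_congruentNumber_of_converse hBT hK hGZK hS)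
  have := h hsq.ne_zero
  rwa [quadraticTwist_congruentNumberCurve_one] at this

/-- **`100 %` of the squarefree `n ≡ 5, 6, 7 (mod 8)` are congruent numbers, conditionally — the
density-one implication** (Kříž, v5 Thm. 10.17 (3), second clause): among the squarefree `d`, the
implication "`|d| ≡ 5, 6, 7 (mod 8) ⟹ |d|` is the area of a rational right triangle" holds on a set
of density `1` — on the density-one set of the BSD rank formula
(`bsdRank_densityOne_congruentNumber_of_converse'`) by `isCongruentNumber_of_mod_eight_of_BSD'`
(`L(E_n, 1) = 0` on these classes). [cite: Kriz2020, Thm. 10.17 (3) (v5)]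
[cite: KoblitzECMF1993, Ch. II §5, Theorem (p. 84)] -/
theorem twistDensity_isCongruentNumber_of_mod_eight_of_converse
    (hBT : burungaleTian_analyticRank_eq_zero_of_selmerCorank_eq_zero_of_hasCM)
    (hK : rankOne_twoConverse_congruentNumber)
    (hGZK : rank_eq_analyticRank_of_analyticRank_le_one)
    (hS : smith_selmerCorank_density (congruentNumberCurve 1)) :
    twistDensity (fun d ↦ (d.natAbs % 8 = 5 ∨ d.natAbs % 8 = 6 ∨ d.natAbs % 8 = 7) →
      IsCongruentNumber d.natAbs) 1 := by
  refine twistDensity_one_mono (fun d hsq hBSD h8 ↦ ?_)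
    (bsdRank_densityOne_congruentNumber_of_converse' hBT hK hGZK hS)
  exact isCongruentNumber_of_mod_eight_of_BSD' (Int.squarefree_natAbs.mpr hsq) h8 hBSD

/-! ### The printed conditional density (Modularity supplies the density of the class) -/

/-- A squarefree natural number is `≢ 0, 4 (mod 8)`. [folklore] -/
private theorem not_four_dvd_of_squarefree {n : ℕ} (hsq : Squarefree n) : ¬ 4 ∣ n := fun h ↦
  absurd (Nat.isUnit_iff.mp (hsq 2 h)) (by norm_num)

/-- **`w(E_n) = −1` iff `n ≡ 5, 6, 7 (mod 8)`** for squarefree `n`, granted Modularity (the tree's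
root number table of the congruent number curves: `rootNumber_congruentNumberCurve_eq_one_of_mod_eight`
unconditionally on `1, 2, 3`, `rootNumber_congruentNumberCurve_eq_neg_one_of_mod_eight` on `5, 6, 7`;
Koblitz, Ch. II §5, p. 84). [cite: KoblitzECMF1993, Ch. II §5, Theorem (p. 84)] -/
theorem rootNumber_congruentNumberCurve_eq_neg_one_iff (hmod : exists_isNewformOf) {n : ℕ}
    (hsq : Squarefree n) :
    (congruentNumberCurve n).rootNumber = -1 ↔ (n % 8 = 5 ∨ n % 8 = 6 ∨ n % 8 = 7) := by
  refine ⟨fun h ↦ ?_, rootNumber_congruentNumberCurve_eq_neg_one_of_mod_eight hmod hsq⟩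
  have h4 := not_four_dvd_of_squarefree hsq
  by_contra h567
  have h123 : n % 8 = 1 ∨ n % 8 = 2 ∨ n % 8 = 3 := by omega
  have h1 := rootNumber_congruentNumberCurve_eq_one_of_mod_eight hsq h123
  rw [h1] at h
  norm_num at h

/-- **The classes `5, 6, 7 (mod 8)` carry half of the squarefree integers** (granted Modularity):
`{d squarefree : |d| ≡ 5, 6, 7 (mod 8)}` has density `1/2`, being the root-number-`−1` class of the
twist family of `y² = x³ − x` (`twistDensity_rootNumber_quadraticTwist_eq_neg_one`, Murty–Murty
Ch. 6 §1; `rootNumber_congruentNumberCurve_eq_neg_one_iff`). [cite: MurtyMurty1997, Ch. 6 §1] -/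
theorem twistDensity_mod_eight_congruentNumber (hmod : exists_isNewformOf) :
    twistDensity (fun d ↦ d.natAbs % 8 = 5 ∨ d.natAbs % 8 = 6 ∨ d.natAbs % 8 = 7) (1 / 2) := by
  haveI := isElliptic_congruentNumberCurve one_ne_zero
  have h := twistDensity_rootNumber_quadraticTwist_eq_neg_one (congruentNumberCurve 1) hmod
  refine (twistDensity_congr (fun d hsq ↦ ?_) _).1 h
  rw [quadraticTwist_congruentNumberCurve_one,
    rootNumber_congruentNumberCurve_eq_neg_one_iff hmod (Int.squarefree_natAbs.mpr hsq)]
  exact and_iff_right hsq.ne_zero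

/-- **The congruent numbers among the classes `5, 6, 7 (mod 8)` also have density `1/2`**,
conditionally: intersect the class (density `1/2`, Modularity) with the density-one implication
`twistDensity_isCongruentNumber_of_mod_eight_of_converse` (`twistDensity_congr_of_one`).
[cite: Kriz2020, Thm. 10.17 (3) (v5)] -/
theorem twistDensity_mod_eight_and_isCongruentNumber_of_converse (hmod : exists_isNewformOf)
    (hBT : burungaleTian_analyticRank_eq_zero_of_selmerCorank_eq_zero_of_hasCM)
    (hK : rankOne_twoConverse_congruentNumber)
    (hGZK : rank_eq_analyticRank_of_analyticRank_le_one)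
    (hS : smith_selmerCorank_density (congruentNumberCurve 1)) :
    twistDensity (fun d ↦ (d.natAbs % 8 = 5 ∨ d.natAbs % 8 = 6 ∨ d.natAbs % 8 = 7) ∧
      IsCongruentNumber d.natAbs) (1 / 2) :=
  (twistDensity_congr_of_one (twistDensity_isCongruentNumber_of_mod_eight_of_converse hBT hK hGZK hS)
    (fun _ _ himp ↦ (and_iff_left_of_imp himp).symm)).1 (twistDensity_mod_eight_congruentNumber hmod)

/-- **Conditional densities over a class of positive density**: if `Q` has density `δ ≠ 0` among
the squarefree integers and `Q ∧ P` has density `δ` too, then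
`#{d sqfree, |d| ≤ X : Q d ∧ P d} / #{d sqfree, |d| ≤ X : Q d} → 1` — "`100 %` of the squarefree
`d` with `Q` satisfy `P`". [folklore] -/
private theorem twistDensity.tendsto_card_div_card {P Q : ℤ → Prop} {δ : ℝ} (hδ : δ ≠ 0)
    (hQP : twistDensity (fun d ↦ Q d ∧ P d) δ) (hQ : twistDensity Q δ) :
    Tendsto (fun X : ℕ ↦ (Nat.card {d : ℤ | Squarefree d ∧ |d| ≤ (X : ℤ) ∧ (Q d ∧ P d)} : ℝ) /
      Nat.card {d : ℤ | Squarefree d ∧ |d| ≤ (X : ℤ) ∧ Q d}) atTop (𝓝 1) := by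
  have h := hQP.div hQ hδ
  rw [div_self hδ] at h
  refine h.congr' ?_
  filter_upwards [eventually_ge_atTop 1] with X hX
  have hS : (Nat.card {d : ℤ | Squarefree d ∧ |d| ≤ (X : ℤ)} : ℝ) ≠ 0 := by
    have hfin : ({d : ℤ | Squarefree d ∧ |d| ≤ (X : ℤ)}).Finite :=
      (Set.finite_Icc (-(X : ℤ)) X).subset fun d hd ↦ abs_le.mp hd.2
    have h1 : (1 : ℤ) ∈ {d : ℤ | Squarefree d ∧ |d| ≤ (X : ℤ)} :=
      ⟨squarefree_one, by simpa using hX⟩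
    haveI : Finite {d : ℤ | Squarefree d ∧ |d| ≤ (X : ℤ)} := hfin.to_subtype
    have hne : Nat.card {d : ℤ | Squarefree d ∧ |d| ≤ (X : ℤ)} ≠ 0 :=
      Nat.card_ne_zero.mpr ⟨⟨⟨1, h1⟩⟩, inferInstance⟩
    exact_mod_cast hne
  simp only [Pi.div_apply]
  rw [div_div_div_cancel_right₀ hS]

/-- **Kříž, v5 Theorem 10.17 (3), second clause, as printed — conditionally: "`100 %` of squarefree
positive integers `d ≡ 5, 6, 7 (mod 8)` are congruent numbers."** Granted Modularity, Smith's
Thm. 1.1 for `y² = x³ − x` (`hS`, arXiv:2503.17619, unrefereed in this generality; refereed JAMS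
2026 form in the twin `…_nat_of_converse_of_smith2022`), Burungale–Tian's rank-zero `2`-converse,
Gross–Zagier–Kolyvagin and the ONE input from the preprint under review, `hK` (Kříž's rank-one
`2`-converse for `y² = x³ − n²x`):
`#{d squarefree, |d| ≤ X, |d| ≡ 5, 6, 7 (mod 8), |d| congruent} /
 #{d squarefree, |d| ≤ X, |d| ≡ 5, 6, 7 (mod 8)} ⟶ 1` as `X → ∞` (each positive squarefree `n`
is counted twice, as `d = ±n`, in numerator and denominator alike).
[cite: Kriz2020, Thm. 10.17 (3) (v5; = Cor. 8.9 of v1)] [cite: SmithGoldfeld2025, Thm. 1.1]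
[cite: MurtyMurty1997, Ch. 6 §1] -/
theorem tendsto_card_isCongruentNumber_div_card_mod_eight_of_converse (hmod : exists_isNewformOf)
    (hBT : burungaleTian_analyticRank_eq_zero_of_selmerCorank_eq_zero_of_hasCM)
    (hK : rankOne_twoConverse_congruentNumber)
    (hGZK : rank_eq_analyticRank_of_analyticRank_le_one)
    (hS : smith_selmerCorank_density (congruentNumberCurve 1)) :
    Tendsto (fun X : ℕ ↦
      (Nat.card {d : ℤ | Squarefree d ∧ |d| ≤ (X : ℤ) ∧
          ((d.natAbs % 8 = 5 ∨ d.natAbs % 8 = 6 ∨ d.natAbs % 8 = 7) ∧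
            IsCongruentNumber d.natAbs)} : ℝ) /
        Nat.card {d : ℤ | Squarefree d ∧ |d| ≤ (X : ℤ) ∧
          (d.natAbs % 8 = 5 ∨ d.natAbs % 8 = 6 ∨ d.natAbs % 8 = 7)}) atTop (𝓝 1) :=
  twistDensity.tendsto_card_div_card (by norm_num)
    (twistDensity_mod_eight_and_isCongruentNumber_of_converse hmod hBT hK hGZK hS)
    (twistDensity_mod_eight_congruentNumber hmod)

/-- The sign symmetry of the twist count (`d = ±n`): for any property `P` of `|d|`,
`#{d ∈ ℤ squarefree, |d| ≤ X, P |d|} = 2 · #{n ∈ ℕ squarefree, n ≤ X, P n}` (`0` is not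
squarefree, and `d ↦ |d|` is two-to-one on nonzero integers). [folklore] -/
private theorem natCard_squarefree_int_eq_two_mul (X : ℕ) (P : ℕ → Prop) :
    Nat.card {d : ℤ | Squarefree d ∧ |d| ≤ (X : ℤ) ∧ P d.natAbs} =
      2 * Nat.card {n : ℕ | Squarefree n ∧ n ≤ X ∧ P n} := by
  set S : Set ℕ := {n : ℕ | Squarefree n ∧ n ≤ X ∧ P n} with hS
  have hSfin : S.Finite := (Set.finite_Iic X).subset fun n hn ↦ hn.2.1
  have h0 : (0 : ℕ) ∉ S := fun h ↦ not_squarefree_zero h.1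
  have hT : {d : ℤ | Squarefree d ∧ |d| ≤ (X : ℤ) ∧ P d.natAbs} =
      ((fun n : ℕ ↦ (n : ℤ)) '' S) ∪ ((fun n : ℕ ↦ -(n : ℤ)) '' S) := by
    ext d
    simp only [Set.mem_setOf_eq, Set.mem_union, Set.mem_image]
    constructor
    · rintro ⟨hsq, hle, hP⟩
      have hsq' : Squarefree d.natAbs := Int.squarefree_natAbs.2 hsq
      have hle' : d.natAbs ≤ X := by
        rw [Int.abs_eq_natAbs] at hle
        exact_mod_cast hle
      rcases Int.natAbs_eq d with h | h
      · exact Or.inl ⟨d.natAbs, ⟨hsq', hle', hP⟩, h.symm⟩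
      · exact Or.inr ⟨d.natAbs, ⟨hsq', hle', hP⟩, h.symm⟩
    · rintro (⟨n, ⟨hsq, hle, hP⟩, rfl⟩ | ⟨n, ⟨hsq, hle, hP⟩, rfl⟩)
      · refine ⟨Int.squarefree_natCast.2 hsq, ?_, by simpa using hP⟩
        rw [Nat.abs_cast]; exact_mod_cast hle
      · refine ⟨Int.squarefree_natAbs.1 (by simpa using hsq), ?_, by simpa using hP⟩
        rw [abs_neg, Nat.abs_cast]; exact_mod_cast hle
  have hdisj : Disjoint ((fun n : ℕ ↦ (n : ℤ)) '' S) ((fun n : ℕ ↦ -(n : ℤ)) '' S) := by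
    rw [Set.disjoint_left]
    rintro d ⟨n, hn, rfl⟩ ⟨m, hm, hnm⟩
    have : (n : ℤ) = 0 := by
      have h1 : (0 : ℤ) ≤ n := by positivity
      have h2 : (0 : ℤ) ≤ m := by positivity
      linarith
    have hn0 : n = 0 := by exact_mod_cast this
    exact h0 (hn0 ▸ hn)
  have hinj : Function.Injective (fun n : ℕ ↦ -(n : ℤ)) := fun a b h ↦ by
    simpa using h
  rw [Nat.card_coe_set_eq, Nat.card_coe_set_eq, hT,
    Set.ncard_union_eq hdisj (hSfin.image _) (hSfin.image _),
    Set.ncard_image_of_injective S Nat.cast_injective,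
    Set.ncard_image_of_injective S hinj, two_mul]

/-- **Kříž, v5 Theorem 10.17 (3), second clause, as printed, over the POSITIVE INTEGERS —
conditionally: "`100 %` of squarefree positive integers `d ≡ 5, 6, 7 (mod 8)` are congruent
numbers."** Same hypotheses as `tendsto_card_isCongruentNumber_div_card_mod_eight_of_converse`:
`#{n ≤ X squarefree, n ≡ 5, 6, 7 (mod 8), n congruent} / #{n ≤ X squarefree, n ≡ 5, 6, 7 (mod 8)} ⟶ 1`
as `X → ∞` (`n ∈ ℕ`; from the `d = ±n` form by the two-to-one symmetry
`natCard_squarefree_int_eq_two_mul`).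
[cite: Kriz2020, Thm. 10.17 (3) (v5; = Cor. 8.9 of v1)] [cite: SmithGoldfeld2025, Thm. 1.1]
[cite: MurtyMurty1997, Ch. 6 §1] -/
theorem tendsto_card_isCongruentNumber_div_card_mod_eight_nat_of_converse
    (hmod : exists_isNewformOf)
    (hBT : burungaleTian_analyticRank_eq_zero_of_selmerCorank_eq_zero_of_hasCM)
    (hK : rankOne_twoConverse_congruentNumber)
    (hGZK : rank_eq_analyticRank_of_analyticRank_le_one)
    (hS : smith_selmerCorank_density (congruentNumberCurve 1)) :
    Tendsto (fun X : ℕ ↦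
      (Nat.card {n : ℕ | Squarefree n ∧ n ≤ X ∧
          ((n % 8 = 5 ∨ n % 8 = 6 ∨ n % 8 = 7) ∧ IsCongruentNumber n)} : ℝ) /
        Nat.card {n : ℕ | Squarefree n ∧ n ≤ X ∧ (n % 8 = 5 ∨ n % 8 = 6 ∨ n % 8 = 7)})
      atTop (𝓝 1) := by
  refine (tendsto_card_isCongruentNumber_div_card_mod_eight_of_converse hmod hBT hK hGZK hS).congr
    fun X ↦ ?_
  have e1 : (Nat.card {d : ℤ | Squarefree d ∧ |d| ≤ (X : ℤ) ∧
      ((d.natAbs % 8 = 5 ∨ d.natAbs % 8 = 6 ∨ d.natAbs % 8 = 7) ∧ IsCongruentNumber d.natAbs)} : ℝ) =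
      2 * Nat.card {n : ℕ | Squarefree n ∧ n ≤ X ∧
        ((n % 8 = 5 ∨ n % 8 = 6 ∨ n % 8 = 7) ∧ IsCongruentNumber n)} := by
    exact_mod_cast natCard_squarefree_int_eq_two_mul X
      (fun n ↦ (n % 8 = 5 ∨ n % 8 = 6 ∨ n % 8 = 7) ∧ IsCongruentNumber n)
  have e2 : (Nat.card {d : ℤ | Squarefree d ∧ |d| ≤ (X : ℤ) ∧
      (d.natAbs % 8 = 5 ∨ d.natAbs % 8 = 6 ∨ d.natAbs % 8 = 7)} : ℝ) =
      2 * Nat.card {n : ℕ | Squarefree n ∧ n ≤ X ∧ (n % 8 = 5 ∨ n % 8 = 6 ∨ n % 8 = 7)} := by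
    exact_mod_cast natCard_squarefree_int_eq_two_mul X
      (fun n ↦ n % 8 = 5 ∨ n % 8 = 6 ∨ n % 8 = 7)
  show _ = (_ : ℝ) / _
  rw [e1, e2, mul_div_mul_left _ _ (two_ne_zero' ℝ)]

/-! ### The complementary classes `1, 2, 3 (mod 8)` -/

/-- **`100 %` of the squarefree `n ≡ 1, 2, 3 (mod 8)` are NOT congruent numbers, conditionally —
the density-one implication** (Kříž, v5 Thm. 10.17 (3), first clause). On the density-one set
`{r_2(E^d) ≤ 1}`: `w(E_{|d|}) = +1` on these classes (`rootNumber_congruentNumberCurve_eq_one_of_mod_eight`,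
unconditional), so `r_an(E_{|d|})` is even (Modularity, `even_analyticRank_iff_rootNumber_eq_one_of_exists_isNewformOf`);
`r_2 = 1` would give `r_an = 1` (`hK`), odd — so `r_2 = 0`, `rank ≤ r_2 = 0`
(`selmerCorank_eq_mordellWeilRank_add_holds`), and rank `0` means not congruent
(`Wiles2000.mordellWeilRank_ne_zero_iff_isCongruentNumber`). (Burungale–Tian's converse is not
needed on this side.) [cite: Kriz2020, Thm. 10.17 (3) (v5)] [cite: SmithGoldfeld2025, Thm. 1.1] -/
theorem twistDensity_not_isCongruentNumber_of_mod_eight_of_converse (hmod : exists_isNewformOf)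
    (hK : rankOne_twoConverse_congruentNumber)
    (hS : smith_selmerCorank_density (congruentNumberCurve 1)) :
    twistDensity (fun d ↦ (d.natAbs % 8 = 1 ∨ d.natAbs % 8 = 2 ∨ d.natAbs % 8 = 3) →
      ¬ IsCongruentNumber d.natAbs) 1 := by
  refine twistDensity_one_mono (fun d hsq hRd h8 ↦ ?_)
    (twistDensity_selmerCorankTwoInfty_le_one_of (congruentNumberCurve 1) hS)
  obtain ⟨hd, hle⟩ := hRd
  rw [selmerCorankTwoInfty_eq, quadraticTwist_congruentNumberCurve_one] at hle
  have hn : d.natAbs ≠ 0 := Int.natAbs_ne_zero.mpr hd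
  have hsq' : Squarefree d.natAbs := Int.squarefree_natAbs.mpr hsq
  haveI := isElliptic_congruentNumberCurve hn
  haveI : Fact (Nat.Prime 2) := ⟨Nat.prime_two⟩
  have hw : (congruentNumberCurve d.natAbs).rootNumber = 1 :=
    rootNumber_congruentNumberCurve_eq_one_of_mod_eight hsq' h8
  have heven : Even (congruentNumberCurve d.natAbs).analyticRank :=
    (even_analyticRank_iff_rootNumber_eq_one_of_exists_isNewformOf (congruentNumberCurve d.natAbs)
      hmod).mpr hw
  have h0 : (congruentNumberCurve d.natAbs).selmerCorank 2 = 0 := by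
    rcases Nat.le_one_iff_eq_zero_or_eq_one.mp hle with h0 | h1
    · exact h0
    · exfalso
      have h := hK hn h1
      rw [h] at heven
      exact Nat.not_even_one heven
  have hrk : (congruentNumberCurve d.natAbs).mordellWeilRank = 0 := by
    have := (congruentNumberCurve d.natAbs).selmerCorank_eq_mordellWeilRank_add_holds 2
    omega
  intro hc
  exact (Wiles2000.mordellWeilRank_ne_zero_iff_isCongruentNumber (Nat.pos_of_ne_zero hn)).mpr hc hrk

/-! ### The refereed route for the Smith input: J. Amer. Math. Soc. 39 (2026), Thm. 1.2, with its Assumption 1.1 (3) DISCHARGED for `y² = x³ − n²x`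

On this route the trust base of every conclusion above is: ONE unrefereed binder (`hK`, Kříž) +
refereed print — A. Smith, J. Amer. Math. Soc. 39 (2026), doi:10.1090/jams/1062, Thm. 1.2
(`h22 : smith2022_selmerCorank_distribution`, stated over `smi22aAssumption`), Burungale–Tian,
Ann. of Math. 203 (2026), Thm. 1.1 (`hBT`), Gross–Zagier 1986 / Kolyvagin 1990 (`hGZK`), Modularity
(`hmod`). The verification that `y² = x³ − x` satisfies Assumption 1.1 (3) — in print Smith,
arXiv:1702.02325, p. 2 ("By applying this corollary to … `y² = x³ − x`"), Burungale–Tian,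
Ann. of Math. 203 (2026), Thm. 3.3, Pan–Tian 2025, p. 3 — is a THEOREM of the tree
(`smithCaseI_example`, `BSDSelmerSmithCasesExplicitProofs`); it is redone here for every `E_n`. -/

/-- **Every congruent number curve `E_n : y² = x³ − n²x = x(x − n)(x + n)` (`n ≠ 0`) is in Smith's
Case I** (arXiv:2503.17619, Def. 1.6: `E(ℚ)[2] ≅ (ℤ/2ℤ)²` and no balanced isogeny): with roots
`0, n, −n`, none of `n·(−n) = −n²`, `n(n + n) = 2n²`, `(−n)(−n − n) = 2n²` is a square in `ℚ`
(`smithCaseI_iff_of_roots`). [cite: SmithGoldfeld2025, Def. 1.6] [cite: Smith2017SelmerGoldfeld, p. 2] -/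
theorem smithCaseI_congruentNumberCurve {n : ℕ} (hn : n ≠ 0) :
    smithCaseI (congruentNumberCurve n) := by
  haveI := isElliptic_congruentNumberCurve hn
  haveI : (congruentNumberCurve n).IsTwoTorsionNF := ⟨rfl, rfl, rfl⟩
  have hn' : (n : ℚ) ≠ 0 := Nat.cast_ne_zero.mpr hn
  have hpos : (0 : ℚ) < n := Nat.cast_pos.mpr (Nat.pos_of_ne_zero hn)
  have h2 : ¬ IsSquare (2 : ℚ) := by norm_num
  have hsq : ¬ IsSquare (2 * (n : ℚ) ^ 2) := by
    rintro ⟨q, hq⟩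
    refine h2 ⟨q / n, ?_⟩
    field_simp
    linear_combination hq
  refine (smithCaseI_iff_of_roots (congruentNumberCurve n) (r := (n : ℚ)) (s := -(n : ℚ))
    (show (congruentNumberCurve n).a₂ = -((n : ℚ) + -(n : ℚ)) by simp [congruentNumberCurve])
    (show (congruentNumberCurve n).a₄ = (n : ℚ) * -(n : ℚ) by
      simp [congruentNumberCurve]; ring)).mpr ⟨?_, ?_, ?_⟩
  · rintro ⟨q, hq⟩
    nlinarith [mul_self_nonneg q, mul_pos hpos hpos]
  · rw [show (n : ℚ) * (n - -(n : ℚ)) = 2 * (n : ℚ) ^ 2 by ring]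
    exact hsq
  · rw [show -(n : ℚ) * (-(n : ℚ) - n) = 2 * (n : ℚ) ^ 2 by ring]
    exact hsq

/-- **Every congruent number curve satisfies the standing Assumption 1.1 of A. Smith,
J. Amer. Math. Soc. 39 (2026) (arXiv:2207.05674), in its branch (3)**: `E_n(ℚ)[2] ≅ (ℤ/2ℤ)²` and
`E_n` has no cyclic degree-`4` isogeny defined over `ℚ` (Case I `⟹` Assumption 1.1,
`smi22aAssumption_of_smithCaseI`, through "no balanced isogeny `⟺` no cyclic `4`-isogeny",
`forall_not_isBalanced_iff_forall_not_isCyclic`). For `n = 1` this is the clause that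
A. Smith, arXiv:1702.02325, p. 2, Burungale–Tian, Ann. of Math. 203 (2026), Thm. 3.3, and
Pan–Tian (2025), p. 3, verify in print. [cite: Smith2026SelmerTwistI, Assumption 1.1 (3)]
[cite: BurungaleTian2026, Thm. 3.3] -/
theorem smi22aAssumption_congruentNumberCurve {n : ℕ} (hn : n ≠ 0) :
    smi22aAssumption (congruentNumberCurve n) := by
  haveI := isElliptic_congruentNumberCurve hn
  exact smi22aAssumption_of_smithCaseI _ (smithCaseI_congruentNumberCurve hn)

/-- **Smith's `1/2, 1/2, 0` distribution for the quadratic twists of `E_n : y² = x³ − n²x`, from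
the REFEREED theorem**: A. Smith, J. Amer. Math. Soc. 39 (2026), Thm. 1.2
(`h22 : smith2022_selmerCorank_distribution`, stated under Assumption 1.1), applied to `E_n`, which
satisfies Assumption 1.1 (3) (`smi22aAssumption_congruentNumberCurve`); the passage from the
printed limit over `0 < |d| ≤ H` to the tree's density over squarefree `d` is
`smith_selmerCorank_density_of_smi22a_printed` (`BSDSelmerSmithAssumptionProofs`, proved). So for
the congruent number family the unrefereed arXiv:2503.17619 is not needed.
[cite: Smith2026SelmerTwistI, Thm. 1.2 with Assumption 1.1 (3)] -/
theorem smith_selmerCorank_density_congruentNumberCurve_of_smith2022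
    (h22 : smith2022_selmerCorank_distribution) {n : ℕ} (hn : n ≠ 0) :
    smith_selmerCorank_density (congruentNumberCurve n) := by
  haveI := isElliptic_congruentNumberCurve hn
  exact smith_selmerCorank_density_of_smi22a_printed (fun A _ hA ↦ h22 A hA) (congruentNumberCurve n)
    (smi22aAssumption_congruentNumberCurve hn)

/-- **Goldfeld's conjecture for the congruent number family, conditionally, on the refereed route**
(twin of `goldfeld_congruentNumberCurve_of_converse`): `50 %` of the quadratic twists of
`y² = x³ − x` have analytic rank `0` and `50 %` have analytic rank `1`, granted Burungale–Tian
(Ann. of Math. 2026), KŘÍŽ (`hK`, the only unrefereed binder) and A. Smith, J. Amer. Math. Soc. 39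
(2026), Thm. 1.2 (`h22`). [cite: Kriz2020, Thm. 10.17 (1), (3) (v5)]
[cite: Smith2026SelmerTwistI, Thm. 1.2] [cite: BurungaleTian2026, Thm. 1.1] -/
theorem goldfeld_congruentNumberCurve_of_converse_of_smith2022
    (hBT : burungaleTian_analyticRank_eq_zero_of_selmerCorank_eq_zero_of_hasCM)
    (hK : rankOne_twoConverse_congruentNumber) (h22 : smith2022_selmerCorank_distribution) :
    twistDensity
        (fun d ↦ d ≠ 0 ∧ ((congruentNumberCurve 1).quadraticTwist d).analyticRank = 0) (1 / 2) ∧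
      twistDensity
        (fun d ↦ d ≠ 0 ∧ ((congruentNumberCurve 1).quadraticTwist d).analyticRank = 1) (1 / 2) :=
  goldfeld_congruentNumberCurve_of_converse hBT hK
    (smith_selmerCorank_density_congruentNumberCurve_of_smith2022 h22 one_ne_zero)

/-- **The cell's consumer on the refereed route** (twin of
`bsdRank_densityOne_congruentNumber_of_converse`): the Birch–Swinnerton-Dyer RANK formula
`ord_{s=1} L(E^d, s) = rank_ℤ E^d(ℚ)` holds for a density-one set of the quadratic twists `E^d` of
`y² = x³ − x`, granted refereed print — Burungale–Tian, Ann. of Math. 203 (2026), Thm. 1.1 (`hBT`),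
Gross–Zagier–Kolyvagin (`hGZK`), A. Smith, J. Amer. Math. Soc. 39 (2026), Thm. 1.2 (`h22`) — and
EXACTLY ONE unrefereed binder, Kříž's rank-one `2`-converse `hK` (arXiv:2002.04767v5,
Thm. 10.17 (2) ⊂ Thm. 10.13; second claimed proof Fan–Wan, arXiv:2304.09806v2, Thm. 1.1).
[cite: Kriz2020, Thm. 10.17 (2)-(3) (v5)] [cite: Smith2026SelmerTwistI, Thm. 1.2]
[cite: BurungaleTian2026, Thm. 1.1] -/
theorem bsdRank_densityOne_congruentNumber_of_converse_of_smith2022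
    (hBT : burungaleTian_analyticRank_eq_zero_of_selmerCorank_eq_zero_of_hasCM)
    (hK : rankOne_twoConverse_congruentNumber)
    (hGZK : rank_eq_analyticRank_of_analyticRank_le_one)
    (h22 : smith2022_selmerCorank_distribution) :
    twistDensity (fun d ↦ d ≠ 0 →
      ((congruentNumberCurve 1).quadraticTwist d).analyticRank =
        ((congruentNumberCurve 1).quadraticTwist d).mordellWeilRank) 1 :=
  bsdRank_densityOne_congruentNumber_of_converse hBT hK hGZK
    (smith_selmerCorank_density_congruentNumberCurve_of_smith2022 h22 one_ne_zero)

/-- The refereed-route consumer read on the curves `E_{|d|}` themselves (twin of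
`bsdRank_densityOne_congruentNumber_of_converse'`). [cite: Kriz2020, Thm. 10.17 (2)-(3) (v5)]
[cite: Smith2026SelmerTwistI, Thm. 1.2] -/
theorem bsdRank_densityOne_congruentNumber_of_converse_of_smith2022'
    (hBT : burungaleTian_analyticRank_eq_zero_of_selmerCorank_eq_zero_of_hasCM)
    (hK : rankOne_twoConverse_congruentNumber)
    (hGZK : rank_eq_analyticRank_of_analyticRank_le_one)
    (h22 : smith2022_selmerCorank_distribution) :
    twistDensity (fun d ↦ (congruentNumberCurve d.natAbs).analyticRank =
      (congruentNumberCurve d.natAbs).mordellWeilRank) 1 :=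
  bsdRank_densityOne_congruentNumber_of_converse' hBT hK hGZK
    (smith_selmerCorank_density_congruentNumberCurve_of_smith2022 h22 one_ne_zero)

/-- **`100 %` of the squarefree `n ≡ 5, 6, 7 (mod 8)` are congruent numbers — the density-one
implication, on the refereed route** (twin of
`twistDensity_isCongruentNumber_of_mod_eight_of_converse`). [cite: Kriz2020, Thm. 10.17 (3) (v5)]
[cite: Smith2026SelmerTwistI, Thm. 1.2] [cite: KoblitzECMF1993, Ch. II §5, Theorem (p. 84)] -/
theorem twistDensity_isCongruentNumber_of_mod_eight_of_converse_of_smith2022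
    (hBT : burungaleTian_analyticRank_eq_zero_of_selmerCorank_eq_zero_of_hasCM)
    (hK : rankOne_twoConverse_congruentNumber)
    (hGZK : rank_eq_analyticRank_of_analyticRank_le_one)
    (h22 : smith2022_selmerCorank_distribution) :
    twistDensity (fun d ↦ (d.natAbs % 8 = 5 ∨ d.natAbs % 8 = 6 ∨ d.natAbs % 8 = 7) →
      IsCongruentNumber d.natAbs) 1 :=
  twistDensity_isCongruentNumber_of_mod_eight_of_converse hBT hK hGZK
    (smith_selmerCorank_density_congruentNumberCurve_of_smith2022 h22 one_ne_zero)

/-- **Kříž, v5 Theorem 10.17 (3), second clause, as printed, over the squarefree `d ∈ ℤ`, on the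
refereed route** (twin of `tendsto_card_isCongruentNumber_div_card_mod_eight_of_converse`):
`#{d squarefree, |d| ≤ X, |d| ≡ 5, 6, 7 (mod 8), |d| congruent} /
 #{d squarefree, |d| ≤ X, |d| ≡ 5, 6, 7 (mod 8)} ⟶ 1`, granted Modularity, Burungale–Tian,
Gross–Zagier–Kolyvagin, A. Smith JAMS 2026 Thm. 1.2 (all refereed) and `hK` (Kříž, unrefereed).
[cite: Kriz2020, Thm. 10.17 (3) (v5; = Cor. 8.9 of v1)] [cite: Smith2026SelmerTwistI, Thm. 1.2]
[cite: MurtyMurty1997, Ch. 6 §1] -/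
theorem tendsto_card_isCongruentNumber_div_card_mod_eight_of_converse_of_smith2022
    (hmod : exists_isNewformOf)
    (hBT : burungaleTian_analyticRank_eq_zero_of_selmerCorank_eq_zero_of_hasCM)
    (hK : rankOne_twoConverse_congruentNumber)
    (hGZK : rank_eq_analyticRank_of_analyticRank_le_one)
    (h22 : smith2022_selmerCorank_distribution) :
    Tendsto (fun X : ℕ ↦
      (Nat.card {d : ℤ | Squarefree d ∧ |d| ≤ (X : ℤ) ∧
          ((d.natAbs % 8 = 5 ∨ d.natAbs % 8 = 6 ∨ d.natAbs % 8 = 7) ∧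
            IsCongruentNumber d.natAbs)} : ℝ) /
        Nat.card {d : ℤ | Squarefree d ∧ |d| ≤ (X : ℤ) ∧
          (d.natAbs % 8 = 5 ∨ d.natAbs % 8 = 6 ∨ d.natAbs % 8 = 7)}) atTop (𝓝 1) :=
  tendsto_card_isCongruentNumber_div_card_mod_eight_of_converse hmod hBT hK hGZK
    (smith_selmerCorank_density_congruentNumberCurve_of_smith2022 h22 one_ne_zero)

/-- **"`100 %` of squarefree positive integers `n ≡ 5, 6, 7 (mod 8)` are congruent numbers", as
printed, over the positive integers, on the refereed route** (twin of
`tendsto_card_isCongruentNumber_div_card_mod_eight_nat_of_converse`):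
`#{n ≤ X squarefree, n ≡ 5, 6, 7 (mod 8), n congruent} / #{n ≤ X squarefree, n ≡ 5, 6, 7 (mod 8)} ⟶ 1`
as `X → ∞`. TRUST BASE: Modularity (Wiles, Taylor–Wiles, Breuil–Conrad–Diamond–Taylor),
Burungale–Tian (Ann. of Math. 203 (2026), Thm. 1.1), Gross–Zagier (1986) and Kolyvagin (1990),
A. Smith (J. Amer. Math. Soc. 39 (2026), Thm. 1.2) — refereed —, the tree's own verification that
`y² = x³ − x` satisfies Smith's Assumption 1.1 (3), and ONE unrefereed binder: Kříž's rank-one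
`2`-converse `hK` for `y² = x³ − n²x` (arXiv:2002.04767v5, Thm. 10.17 (2); second claimed proof
Fan–Wan, arXiv:2304.09806v2, Thm. 1.1; stated as open in Tian, Proc. ICM 2022, Conj. B2).
[cite: Kriz2020, Thm. 10.17 (3) (v5; = Cor. 8.9 of v1)] [cite: Smith2026SelmerTwistI, Thm. 1.2]
[cite: BurungaleTian2026, Thm. 1.1] [cite: MurtyMurty1997, Ch. 6 §1] -/
theorem tendsto_card_isCongruentNumber_div_card_mod_eight_nat_of_converse_of_smith2022
    (hmod : exists_isNewformOf)
    (hBT : burungaleTian_analyticRank_eq_zero_of_selmerCorank_eq_zero_of_hasCM)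
    (hK : rankOne_twoConverse_congruentNumber)
    (hGZK : rank_eq_analyticRank_of_analyticRank_le_one)
    (h22 : smith2022_selmerCorank_distribution) :
    Tendsto (fun X : ℕ ↦
      (Nat.card {n : ℕ | Squarefree n ∧ n ≤ X ∧
          ((n % 8 = 5 ∨ n % 8 = 6 ∨ n % 8 = 7) ∧ IsCongruentNumber n)} : ℝ) /
        Nat.card {n : ℕ | Squarefree n ∧ n ≤ X ∧ (n % 8 = 5 ∨ n % 8 = 6 ∨ n % 8 = 7)})
      atTop (𝓝 1) :=
  tendsto_card_isCongruentNumber_div_card_mod_eight_nat_of_converse hmod hBT hK hGZK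
    (smith_selmerCorank_density_congruentNumberCurve_of_smith2022 h22 one_ne_zero)

/-- **`100 %` of the squarefree `n ≡ 1, 2, 3 (mod 8)` are NOT congruent numbers — the density-one
implication, on the refereed route** (twin of
`twistDensity_not_isCongruentNumber_of_mod_eight_of_converse`; Burungale–Tian is not needed on this
side). [cite: Kriz2020, Thm. 10.17 (3) (v5)] [cite: Smith2026SelmerTwistI, Thm. 1.2] -/
theorem twistDensity_not_isCongruentNumber_of_mod_eight_of_converse_of_smith2022
    (hmod : exists_isNewformOf) (hK : rankOne_twoConverse_congruentNumber)
    (h22 : smith2022_selmerCorank_distribution) :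
    twistDensity (fun d ↦ (d.natAbs % 8 = 1 ∨ d.natAbs % 8 = 2 ∨ d.natAbs % 8 = 3) →
      ¬ IsCongruentNumber d.natAbs) 1 :=
  twistDensity_not_isCongruentNumber_of_mod_eight_of_converse hmod hK
    (smith_selmerCorank_density_congruentNumberCurve_of_smith2022 h22 one_ne_zero)

end Literature.NumberTheory.EllipticCurves

end
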